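import Summits.AnomalousDissipation.AnomalousDissipation.Theorems.SawtoothPulseCascadeK1LocalisedCascadePhaseOneStart
import Summits.AnomalousDissipation.AnomalousDissipation.Theorems.SawtoothPulseCascadeK1LocalisedCascadeExactChirpSelf
import Summits.AnomalousDissipation.AnomalousDissipation.Theorems.SawtoothPulseCascadeK1LocalisedCascadePhaseOneStartSeries
import Mathlib.Analysis.Complex.ExponentialBounds
import Literature.Analysis.FluidPDE.ShearStageTransport

/-!
# K1loc, line `Spectral` / thin start — helper: THE PHASE-ONE START NUMBER AT `γ = 8` (S-D start, certified)

Helper file of the prover lane on the crux `K1LocalisedCascade` (stmt-AnomalousDissipation-19491), route `SawtoothPulseCascade`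
(S-B/S-C assembly seat).  **`phaseOne_tracked_energy_le`**: for every cascade parameter set with `γ = 8`, `N₀ = 1`,
`0 < δ₀ ≤ 2⁻³⁰` (any `d > 0`, any `ρN`) and the explicit inviscid iterate `a₁ = (datum ∘ Φ_{H,0}) ∘ Φ_{V,0}`, the tracked pair of the
amplitude ledger at threshold `K₁ ≤ 4` and aperture `2` carries at most one hundredth:
`Σ'([|k₀| < K₁] + [K₁ ≤ |k₀| ∧ 2|k₀| < γ|k₁|])‖𝓕a₁(k)‖² ≤ 1/100` — i.e. `√E₁ ≤ 1/10` against `‖datum‖ = 1/√2` in the budget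
`(√E_{j₀} + Σ'η)² < ½` of `K1Ledger.From.k1Localised_of_amplitude_ledger` / `_threshold_ledger` with `j₀ = 1`.
Assembly of `…PhaseOneStart` (exact-weight start inequality), `…ExactChirpSelf` (weights at `λ = ±8`, exact chirp witness),
`…ExactChirp`/`…ChirpRounding` (low-pass level `(4|n|+1)/(9π²n²)` per fibre, rounding slope `8(2e^{1/2}−1)δ₀ ≤ 2⁻²⁵`),
`…PhaseOneStartSeries` (the series `≤ 1/110`).  Value of record: the bound proved is `≈ 0.008`; the true value is `0.0037·½`
(kit j299230).  No definitions; nothing about the crux at `δ₀ = ¼`. [cite: Grafakos2014, Prop. 3.1.2 (5) and Prop. 3.2.7 (3)] [problem: turb]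
-/

-- `Summit.<Summit>.<Problem>`: single-conjunct summit, the duplicate namespace segment is deliberate.
set_option linter.dupNamespace false

noncomputable section

namespace Summit.AnomalousDissipation.AnomalousDissipation.Theorems.SawtoothPulseCascade.K1Start

open MeasureTheory Set Filter Topology UnitAddTorus Function Complex AddCircle
open scoped Real
open Literature.Analysis Literature.Analysis.FunctionSpaces Literature.Analysis.FunctionSpaces.Torus Literature.Analysis.FluidPDE
open Literature.Analysis.FluidPDE.ShearStage
open Literature.Analysis.FluidPDE.SawtoothCascade Literature.Analysis.FluidPDE.SawtoothCascade.CascadeParams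

/-! ## §1 Small constants -/

/-- The rounding slope at `γ = 8`: `8(2e^{1/2} − 1)δ₀ ≤ 2⁻²⁵` when `δ₀ ≤ 2⁻³⁰`. [folklore] -/
theorem rounding_slope_le {δ₀ : ℝ} (hδ₀ : 0 ≤ δ₀) (hδ₀' : δ₀ ≤ (2 : ℝ)⁻¹ ^ 30) :
    8 * (2 * Real.exp (1 / 2) - 1) * δ₀ ≤ (2 : ℝ)⁻¹ ^ 25 := by
  -- `e^{1/2} ≤ 5/3` since `(e^{1/2})² = e < 2.72`
  have he : Real.exp (1 / 2) ≤ 5 / 3 := by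
    have h1 : Real.exp (1 / 2) * Real.exp (1 / 2) = Real.exp 1 := by rw [← Real.exp_add]; norm_num
    have h2 := Real.exp_one_lt_d9
    have h0 : 0 < Real.exp (1 / 2) := Real.exp_pos _
    nlinarith
  have h1 : 8 * (2 * Real.exp (1 / 2) - 1) ≤ 2 ^ 5 := by linarith
  have h0 : 0 ≤ 8 * (2 * Real.exp (1 / 2) - 1) := by nlinarith [Real.add_one_le_exp (1 / 2 : ℝ)]
  calc 8 * (2 * Real.exp (1 / 2) - 1) * δ₀ ≤ 2 ^ 5 * ((2 : ℝ)⁻¹ ^ 30) := mul_le_mul h1 hδ₀' hδ₀ (by norm_num)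
    _ = (2 : ℝ)⁻¹ ^ 25 := by norm_num

/-- The low-pass level of fibre `n ≠ 0` at `γ = 8`, aperture `2`: with `λ = 8n`, `Q = 4|n|`,
`(Q+1)·(2|λ|/(π(λ²−Q²)))² = (4|n|+1)/(9π²|n|²)`. [folklore] -/
theorem lowpass_level_eq {n : ℤ} (hn : n ≠ 0) :
    ((4 * n.natAbs : ℕ) + 1 : ℝ) * (2 * |((8 * n : ℤ) : ℝ)| / (π * (((8 * n : ℤ) : ℝ) ^ 2 - ((4 * n.natAbs : ℕ) : ℝ) ^ 2))) ^ 2 =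
      (4 * (n.natAbs : ℝ) + 1) / (9 * π ^ 2 * (n.natAbs : ℝ) ^ 2) := by
  have hπ : 0 < π := Real.pi_pos
  have hm : (n.natAbs : ℝ) = |(n : ℝ)| := (Nat.cast_natAbs n).trans (Int.cast_abs)
  have hm0 : (0 : ℝ) < |(n : ℝ)| := abs_pos.2 (Int.cast_ne_zero.2 hn)
  push_cast
  rw [hm, abs_mul, abs_of_pos (by norm_num : (0:ℝ) < 8)]
  have hsq : ((8 : ℝ) * n) ^ 2 = 64 * |(n : ℝ)| ^ 2 := by rw [mul_pow, sq_abs]; norm_num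
  rw [hsq]
  field_simp
  ring

/-! ## §2 The support of the tracked pair along a fibre -/

/-- **Where the tracked pair of fibre `n ≠ 0` lives**: if `|p| < K₁ ≤ 4` or `2|p| < 8|n|` then `|p + c| ≤ 4|n|` for `c = ±1`.
[folklore] -/
theorem trackedPair_support {K₁ : ℝ} (hK₁ : K₁ ≤ 4) {n : ℤ} (hn : n ≠ 0) {c : ℤ} (hc : c = 1 ∨ c = -1) (p : ℤ)
    (hW : |(p : ℝ)| < K₁ ∨ 2 * |(p : ℝ)| < 8 * |(n : ℝ)|) : |p + c| ≤ ((4 * n.natAbs : ℕ) : ℤ) := by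
  have hn1 : (1 : ℝ) ≤ |(n : ℝ)| := by
    have h := Int.one_le_abs hn
    exact_mod_cast h
  have hp : |(p : ℝ)| < 4 * |(n : ℝ)| := by
    rcases hW with h | h
    · linarith
    · linarith
  have hp' : |p| < 4 * |n| := by
    have h : (|p| : ℝ) < 4 * |n| := by push_cast; exact hp
    exact_mod_cast h
  have hN : ((4 * n.natAbs : ℕ) : ℤ) = 4 * |n| := by push_cast; rfl
  rw [hN]
  rcases hc with rfl | rfl
  · have := abs_add_le p 1
    simp only [abs_one] at this
    omega
  · have := abs_add_le p (-1)
    simp only [abs_neg, abs_one] at this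
    omega

/-! ## §3 The certified start -/

/-- **THE PHASE-ONE START NUMBER.**  `γ = 8`, `N₀ = 1`, `0 < δ₀ ≤ 2⁻³⁰`: for the inviscid iterate `a₁` of the datum and every
threshold `K₁ ≤ 4`, `Σ'([|k₀| < K₁] + [K₁ ≤ |k₀| ∧ 2|k₀| < γ|k₁|])‖𝓕a₁(k)‖² ≤ 1/100`.
[cite: Grafakos2014, Prop. 3.1.2 (5) and Prop. 3.2.7 (3)] -/
theorem phaseOne_tracked_energy_le (P : CascadeParams) (hγ : P.γ = 8) (hN₀ : P.N₀ = 1) (hδ₀ : 0 < P.δ₀)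
    (hδ₀' : P.δ₀ ≤ (2 : ℝ)⁻¹ ^ 30) (hd : 0 < P.d) (a b : ℕ → UnitAddTorus (Fin 2) → ℝ) (h0 : a 0 = datum)
    (hb : b 0 = a 0 ∘ shearMap 0 1 (amp ⟨P.U 0, P.U_periodic 0, P.contDiff_U (P.δ_pos hδ₀ hd 0)⟩ P.γ))
    (hab : a 1 = b 0 ∘ shearMap 1 0 (amp ⟨P.U 0, P.U_periodic 0, P.contDiff_U (P.δ_pos hδ₀ hd 0)⟩ P.γ))
    {K₁ : ℝ} (hK₁ : K₁ ≤ 4) :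
    ∑' k : Fin 2 → ℤ, ((if |((k 0 : ℤ) : ℝ)| < K₁ then (1 : ℝ) else 0) +
        (if K₁ ≤ |((k 0 : ℤ) : ℝ)| ∧ 2 * |((k 0 : ℤ) : ℝ)| < P.γ * |((k 1 : ℤ) : ℝ)| then (1 : ℝ) else 0)) *
      ‖mFourierCoeff (fun x => (a 1 x : ℂ)) k‖ ^ 2 ≤ 1 / 100 := by
  classical
  have hπ : 0 < π := Real.pi_pos
  set ψ : ShearProfile := amp ⟨P.U 0, P.U_periodic 0, P.contDiff_U (P.δ_pos hδ₀ hd 0)⟩ P.γ with hψ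
  have hψt : ∀ t : ℝ, ψ t = 8 * P.U 0 t := fun t => by rw [hψ, amp_apply, hγ]
  -- phase-0 data: one tooth, width `δ₀`
  have hN0 : P.N 0 = 1 := by simp [CascadeParams.N, hN₀]
  have hδ0 : P.δ 0 = P.δ₀ := by simp [CascadeParams.δ]
  -- the rounding: `|ψ − 8·tri(2π·)/(2π)| ≤ η₁`
  set η₁ : ℝ := 8 * ((2 * Real.exp (1 / 2) - 1) * P.δ₀ / (2 * π)) with hη₁
  have hU : ∀ y : ℝ, |P.U 0 y - tri (2 * π * y) / (2 * π)| ≤ (2 * Real.exp (1 / 2) - 1) * P.δ₀ / (2 * π) := by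
    intro y
    have h := abs_U_sub_exactProfile_le P hδ₀ hd (j := 0) (by rw [hN0]; exact one_pos) y
    rw [hN0, hδ0] at h
    simpa using h
  have hη : ∀ t : ℝ, |ψ t - (8 : ℤ) * (tri (2 * π * t) / (2 * π))| ≤ η₁ := by
    intro t
    rw [hψt, show ((8 : ℤ) : ℝ) = 8 by norm_num, ← mul_sub, abs_mul, abs_of_pos (by norm_num : (0:ℝ) < 8), hη₁]
    exact mul_le_mul_of_nonneg_left (hU t) (by norm_num)
  set ε : ℝ := 2 * π * η₁ with hεdef
  have hεval : ε = 8 * (2 * Real.exp (1 / 2) - 1) * P.δ₀ := by rw [hεdef, hη₁]; field_simp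
  have hε0 : 0 ≤ ε := by
    rw [hεval]
    have h : 0 ≤ 2 * Real.exp (1 / 2) - 1 := by linarith [Real.add_one_le_exp (1 / 2 : ℝ)]
    exact mul_nonneg (mul_nonneg (by norm_num) h) hδ₀.le
  have hε : ε ≤ (2 : ℝ)⁻¹ ^ 25 := by rw [hεval]; exact rounding_slope_le hδ₀.le hδ₀'
  -- the weight and its properties
  set W : (Fin 2 → ℤ) → ℝ := fun k => (if |((k 0 : ℤ) : ℝ)| < K₁ then (1 : ℝ) else 0) +
    (if K₁ ≤ |((k 0 : ℤ) : ℝ)| ∧ 2 * |((k 0 : ℤ) : ℝ)| < P.γ * |((k 1 : ℤ) : ℝ)| then (1 : ℝ) else 0) with hWdef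
  have hW0 : ∀ k, 0 ≤ W k := fun k => by simp only [hWdef]; split_ifs <;> norm_num
  have hW1 : ∀ k, W k ≤ 1 := fun k => by
    simp only [hWdef]
    by_cases h1 : |((k 0 : ℤ) : ℝ)| < K₁
    · rw [if_pos h1, if_neg (fun h => (not_le.2 h1) h.1)]; norm_num
    · rw [if_neg h1]; split_ifs <;> norm_num
  have hWsupp : ∀ (n : ℤ), n ≠ 0 → ∀ (c : ℤ), (c = 1 ∨ c = -1) → ∀ p : ℤ, W (![p, n]) ≠ 0 →
      |p + c| ≤ ((4 * n.natAbs : ℕ) : ℤ) := by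
    intro n hn c hc p hp
    refine trackedPair_support hK₁ hn hc p ?_
    by_contra hcon
    push Not at hcon
    apply hp
    simp only [hWdef, Matrix.cons_val_zero, Matrix.cons_val_one, hγ]
    rw [if_neg (not_lt.2 hcon.1), if_neg (fun h => (not_lt.2 hcon.2) h.2), add_zero]
  -- the iterate
  have hb' : b 0 = datum ∘ shearMap 0 1 ψ := by rw [hb, h0]
  have ha' : a 1 = b 0 ∘ shearMap 1 0 ψ := hab
  -- the exact chirps of frequency `±8`
  obtain ⟨gp, hgpc, hgp⟩ := exists_exactChirp 8
  obtain ⟨gm, hgmc, hgm⟩ := exists_exactChirp (-8)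
  have hgm' : ∀ t : ℝ, gm (t : UnitAddCircle) =
      Complex.exp (-(2 * π * I * (-(8 : ℤ)) * ((tri (2 * π * t) / (2 * π) : ℝ) : ℂ))) := fun t => by
    rw [hgm t, Int.cast_neg]
  have hmain := tsum_weight_sq_norm_phaseOne_le_exact ψ hb' ha' hW0 hW1 8 hgp hgm' hgpc hgmc hη
  -- termwise domination of the fibre series by the numeric series term at `m = |n|`
  have hdom : ∀ (c : ℤ), (c = 1 ∨ c = -1) → ∀ {g : UnitAddCircle → ℂ} (lam : ℤ), (lam = 8 ∨ lam = -8) →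
      (∀ t : ℝ, g (t : UnitAddCircle) = Complex.exp (-(2 * π * I * lam * ((tri (2 * π * t) / (2 * π) : ℝ) : ℂ)))) →
      Continuous g → ∀ n : ℤ,
      ‖fourierCoeff g n‖ ^ 2 * ∑' p : ℤ, W (![p, n]) * ‖fourierCoeff (twist ψ n) (p + c)‖ ^ 2 ≤
        (if Odd n.natAbs then (1 / (π * ((8 : ℝ) + n.natAbs)) + 1 / (π * |(8 : ℝ) - n.natAbs|)) ^ 2
          else if n.natAbs = 8 then (1 / 4 : ℝ) else 0) *
        min 1 ((Real.sqrt ((4 * (n.natAbs : ℝ) + 1) / (9 * π ^ 2 * (n.natAbs : ℝ) ^ 2)) + n.natAbs * ε) ^ 2) := by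
    intro c hc g lam hlam hg hgc n
    have hw := sq_norm_fourierCoeff_exactChirp_eight_le hlam hg hgc n
    have hΦ1 : ∑' p : ℤ, W (![p, n]) * ‖fourierCoeff (twist ψ n) (p + c)‖ ^ 2 ≤ 1 := tsum_weight_chirp_le_one ψ n c hW0 hW1
    have hΦ0 : 0 ≤ ∑' p : ℤ, W (![p, n]) * ‖fourierCoeff (twist ψ n) (p + c)‖ ^ 2 :=
      tsum_nonneg fun p => mul_nonneg (hW0 _) (sq_nonneg _)
    have hterm0 := term_nonneg n.natAbs ε
    rcases eq_or_ne n 0 with rfl | hn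
    · -- fibre `0`: the exact weight vanishes (`0` is even and `≠ ±8`)
      have hw0 : ‖fourierCoeff g 0‖ ^ 2 ≤ 0 := by simpa using hw
      exact (mul_nonpos_of_nonpos_of_nonneg hw0 hΦ0).trans hterm0
    · -- the weight in terms of `m = |n|`
      have hm : (n.natAbs : ℝ) = |(n : ℝ)| := (Nat.cast_natAbs n).trans (Int.cast_abs)
      have hwN := weightTable_le_natAbs n
      have hwN0 : 0 ≤ (if Odd n.natAbs then (1 / (π * ((8 : ℝ) + n.natAbs)) + 1 / (π * |(8 : ℝ) - n.natAbs|)) ^ 2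
            else if n.natAbs = 8 then (1 / 4 : ℝ) else 0) := by split_ifs <;> positivity
      -- the capped low-pass level of fibre `n`
      have hΦ : ∑' p : ℤ, W (![p, n]) * ‖fourierCoeff (twist ψ n) (p + c)‖ ^ 2 ≤
          (Real.sqrt ((4 * (n.natAbs : ℝ) + 1) / (9 * π ^ 2 * (n.natAbs : ℝ) ^ 2)) + n.natAbs * ε) ^ 2 := by
        -- the tracked set of fibre `n` sits in `|p + c| ≤ 4|n|`
        have hlow := tsum_weight_chirp_le_lowpass ψ n c hW1 (hWsupp n hn c hc)
        -- the exact chirp of frequency `8n` and its low-pass energy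
        obtain ⟨g8, hg8c, hg8⟩ := exists_exactChirp (8 * n)
        have hev8 : Even (8 * n) := ⟨4 * n, by ring⟩
        have hQ : ((4 * n.natAbs : ℕ) : ℤ) < |8 * n| := by
          rw [abs_mul, abs_of_pos (by norm_num : (0:ℤ) < 8)]
          have := Int.one_le_abs hn
          push_cast; omega
        have hL := sum_sq_norm_fourierCoeff_exactChirp_le_of_even hev8 hg8 hg8c hQ
        rw [lowpass_level_eq hn] at hL
        -- the rounded chirp next to it
        have hηn : ∀ t : ℝ, |n * ψ t - ((8 * n : ℤ)) * (tri (2 * π * t) / (2 * π))| ≤ |(n : ℝ)| * η₁ := by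
          intro t
          have e : (n : ℝ) * ψ t - ((8 * n : ℤ) : ℝ) * (tri (2 * π * t) / (2 * π)) =
              n * (ψ t - (8 : ℤ) * (tri (2 * π * t) / (2 * π))) := by push_cast; ring
          rw [e, abs_mul]
          exact mul_le_mul_of_nonneg_left (hη t) (abs_nonneg _)
        have hR := sqrt_sum_sq_norm_fourierCoeff_twist_le ψ n (8 * n) hg8 hg8c hηn (Finset.Icc (-((4 * n.natAbs : ℕ) : ℤ)) (4 * n.natAbs : ℕ))
        have hsqL : Real.sqrt (∑ q ∈ Finset.Icc (-((4 * n.natAbs : ℕ) : ℤ)) (4 * n.natAbs : ℕ), ‖fourierCoeff g8 q‖ ^ 2) ≤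
            Real.sqrt ((4 * (n.natAbs : ℝ) + 1) / (9 * π ^ 2 * (n.natAbs : ℝ) ^ 2)) := Real.sqrt_le_sqrt hL
        have hεn : 2 * π * (|(n : ℝ)| * η₁) = n.natAbs * ε := by rw [hm, hεdef]; ring
        have hX0 : 0 ≤ Real.sqrt ((4 * (n.natAbs : ℝ) + 1) / (9 * π ^ 2 * (n.natAbs : ℝ) ^ 2)) + n.natAbs * ε := by positivity
        have hS0 : 0 ≤ ∑ q ∈ Finset.Icc (-((4 * n.natAbs : ℕ) : ℤ)) (4 * n.natAbs : ℕ), ‖fourierCoeff (twist ψ n) q‖ ^ 2 :=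
          Finset.sum_nonneg fun q _ => sq_nonneg _
        have hS : ∑ q ∈ Finset.Icc (-((4 * n.natAbs : ℕ) : ℤ)) (4 * n.natAbs : ℕ), ‖fourierCoeff (twist ψ n) q‖ ^ 2 ≤
            (Real.sqrt ((4 * (n.natAbs : ℝ) + 1) / (9 * π ^ 2 * (n.natAbs : ℝ) ^ 2)) + n.natAbs * ε) ^ 2 := by
          rw [← Real.sq_sqrt hS0]
          refine pow_le_pow_left₀ (Real.sqrt_nonneg _) ?_ 2
          rw [← hεn]
          exact hR.trans (by linarith)
        exact hlow.trans hS
      have hΦmin : ∑' p : ℤ, W (![p, n]) * ‖fourierCoeff (twist ψ n) (p + c)‖ ^ 2 ≤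
          min 1 ((Real.sqrt ((4 * (n.natAbs : ℝ) + 1) / (9 * π ^ 2 * (n.natAbs : ℝ) ^ 2)) + n.natAbs * ε) ^ 2) :=
        le_min hΦ1 hΦ
      exact mul_le_mul (hw.trans hwN) hΦmin hΦ0 hwN0
  -- the two fibre series are at most `1/110`
  have hSm : ∑' n : ℤ, ‖fourierCoeff gm n‖ ^ 2 * ∑' p : ℤ, W (![p, n]) * ‖fourierCoeff (twist ψ n) (p + 1)‖ ^ 2 ≤ 1 / 110 :=
    Real.tsum_le_of_sum_le (fun n => mul_nonneg (sq_nonneg _) (tsum_nonneg fun p => mul_nonneg (hW0 _) (sq_nonneg _)))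
      (sum_int_phaseOne_series_le hε0 hε (hdom 1 (Or.inl rfl) (-8) (Or.inr rfl) hgm hgmc))
  have hSp : ∑' n : ℤ, ‖fourierCoeff gp n‖ ^ 2 * ∑' p : ℤ, W (![p, n]) * ‖fourierCoeff (twist ψ n) (p - 1)‖ ^ 2 ≤ 1 / 110 := by
    have h := Real.tsum_le_of_sum_le (fun n => mul_nonneg (sq_nonneg _) (tsum_nonneg fun p => mul_nonneg (hW0 _) (sq_nonneg _)))
      (sum_int_phaseOne_series_le hε0 hε (hdom (-1) (Or.inr rfl) 8 (Or.inl rfl) hgp hgpc))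
    simpa only [← sub_eq_add_neg] using h
  -- assemble: `E₁ ≤ (√(1/110) + ε)² ≤ 1/100`
  have hs110 : Real.sqrt (1 / 110) ≤ 1 / 10 := by
    rw [show (1 / 10 : ℝ) = Real.sqrt ((1 / 10) ^ 2) by rw [Real.sqrt_sq (by norm_num)]]
    exact Real.sqrt_le_sqrt (by norm_num)
  have hroot : (Real.sqrt (1 / 110) + ε) ^ 2 ≤ 1 / 100 := by
    have hsq : Real.sqrt (1 / 110) ^ 2 = 1 / 110 := Real.sq_sqrt (by norm_num)
    have hε' : ε ≤ 1 / 10 ^ 7 := hε.trans (by norm_num)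
    nlinarith [Real.sqrt_nonneg (1 / 110 : ℝ)]
  have hA : (Real.sqrt (∑' n : ℤ, ‖fourierCoeff gm n‖ ^ 2 *
      ∑' p : ℤ, W (![p, n]) * ‖fourierCoeff (twist ψ n) (p + 1)‖ ^ 2) + 2 * π * η₁) ^ 2 ≤ (Real.sqrt (1 / 110) + ε) ^ 2 :=
    pow_le_pow_left₀ (by rw [← hεdef]; positivity) (add_le_add (Real.sqrt_le_sqrt hSm) (le_of_eq hεdef.symm)) 2
  have hB : (Real.sqrt (∑' n : ℤ, ‖fourierCoeff gp n‖ ^ 2 *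
      ∑' p : ℤ, W (![p, n]) * ‖fourierCoeff (twist ψ n) (p - 1)‖ ^ 2) + 2 * π * η₁) ^ 2 ≤ (Real.sqrt (1 / 110) + ε) ^ 2 :=
    pow_le_pow_left₀ (by rw [← hεdef]; positivity) (add_le_add (Real.sqrt_le_sqrt hSp) (le_of_eq hεdef.symm)) 2
  have hWexp : (fun k : Fin 2 → ℤ => W k * ‖mFourierCoeff (fun x => (a 1 x : ℂ)) k‖ ^ 2) =
      fun k => ((if |((k 0 : ℤ) : ℝ)| < K₁ then (1 : ℝ) else 0) +
        (if K₁ ≤ |((k 0 : ℤ) : ℝ)| ∧ 2 * |((k 0 : ℤ) : ℝ)| < P.γ * |((k 1 : ℤ) : ℝ)| then (1 : ℝ) else 0)) *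
      ‖mFourierCoeff (fun x => (a 1 x : ℂ)) k‖ ^ 2 := rfl
  rw [← hWexp]
  refine hmain.trans ?_
  linarith [hA, hB, hroot]

end Summit.AnomalousDissipation.AnomalousDissipation.Theorems.SawtoothPulseCascade.K1Start
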